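import Summits.AtomisticToContinuum.BoseEinsteinCondensation.Theses.BECLiebAntibunching
import HarnessLib.Audit

/-!
# Birth skeleton (BC3) for crux `BECLiebAntibunching.AntibunchingGS`
(item stmt-AtomisticToContinuum-10239, route route-AtomisticToContinuum-BECLiebAntibunching, rank 2;
seat planner-skel-stmt-AtomisticToContinuum-10239-0, 2026-08-17, mode skeleton-register)

Crux (fixed, concluded BY NAME below; Lieb's 1963 anti-bunching `g₂ ≤ 1` in finite-`N` form): for every
BOUNDED repulsive finite-range `v` there is `ρ₀ > 0` such that for `0 < ρ < ρ₀` there is `C` with, for all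
large `N = n+2`, `L = (N/ρ)^{1/3}`: every positive, translation-invariant periodic trial state `Ψ₀`
attaining the periodic ground-state energy has translation-averaged Born pair density
`P(y) = L³ ∫_{cell^{n+1}} |Ψ₀(x₂+y, x₂, x₃, …)|² dX ≤ 1 + C/N` at EVERY separation `y ∈ ℝ³`.

## The line (the route's own two-layer plan (i): `ContactAntibunching` ⇐ far field, by the maximum principle)

The separation variable `y` is cut at the MEAN INTERPARTICLE SCALE in the dimensionless, `rpow`-free form
`ρ·r³ ≶ κ`, where `r = ‖y − Lm‖` runs over the distances from `y` to the lattice `Lℤ³` (the torus distance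
of the pair; `κ` = expected number of particles in the ball of radius `r`).  `P` is `Lℤ³`-periodic in `y`
(periodicity of `Ψ₀` in particle `0`), so the contact region is the union of the balls `ρ‖y − Lm‖³ ≤ κ`
around ALL lattice points and the far region is its complement — a far-field statement over `{‖y‖ ≥ r}`
alone would contain lattice translates of the contact ball and be EQUIVALENT to the crux; that typing was
rejected as a costume.

* `stub_contactFromFarField` — MAXIMUM-PRINCIPLE TRANSPORT INTO THE CONTACT BALLS (the header's "easy
  child" `ContactAntibunching`, made honest: a maximum principle needs its boundary level, so the stub is
  CONDITIONAL on the far-field bound).  There is a fraction `κ = κ(v) > 0` and a threshold `ρ₀` such that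
  for `0 < ρ < ρ₀` and every level `C` there is `C'` with, eventually in `N`: if the ground state's `P` is
  `≤ 1 + C/N` off the contact balls (`κ ≤ ρ‖y − Lm‖³` for all `m`), then `P ≤ 1 + C'/N` inside them.
  Intended engine: for `ρr³ ≲ 1/(4π)` the translation-averaged conditional energy `e(y)` of the positive
  eigenfunction is POSITIVE (near-field scattering energy `∫_{near} eP ≈ 8πa`; `e` changes sign only at
  `r ≈ (4πρ)^{-1/3}`, i.e. `2a²/r⁴ = a/(rξ²)`, route header NUMBERS), so the diagonal, translation-averaged
  contracted Schrödinger identity `Δ_y P = e·P` makes `P` subharmonic on the punctured contact ball and the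
  two-body maximum principle of LSSY Lemma C.2 (`f` nondecreasing, `f ≤ 1`) lifts: no interior maximum
  above the boundary level.  `κ` is EXISTENTIAL (the prover picks the fraction on which `e > 0` is
  provable; typing checklist 4c(iv): no hand-picked threshold) and `C'` is free (`C' = C` if `e ≥ 0` holds
  exactly on the ball; slack for `O(1/N)` leakage).  Size L.  Needs: the identity `Δ_yP = eP` for the `C¹`
  (in fact `W^{2,p}`) minimiser, positivity of the near-field conditional energy at low density.
* `stub_farFieldAntibunching` — ANTI-BUNCHING OFF THE CONTACT BALLS (THE HARD STUB, size XL, the open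
  core): for EVERY fraction `κ > 0`, at low density `ρ < ρ₀(v, κ)` and eventually in `N`, `P(y) ≤ 1 + C/N`
  whenever `κ ≤ ρ‖y − Lm‖³` for all `m ∈ ℤ³`.  Here `e < 0` (`e ≈ −16πρa²/r` in the window
  `a ≪ r ≪ ξ = (8πρa)^{-1/2}`, `e(∞) = −8πa/L³`), so sign alone excludes nothing (the admissible overshoot of
  the bare maximum principle is `εL² = 8πa/L ≫ C/N`, header CHEAPEST FALSIFIER (a)); the intended engine
  is the Poisson representation `P − 1 = G_T ∗ (eP)` on the torus (zero-mean Green's function; near-field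
  source reproduces `−2a/|y|`) with the SCREENING of the Coulomb-like tail at the healing length with the
  right sign (`ScreenedConditionalEnergy` of the header; Bogoliubov level: `g₂ − 1 = ρ⁻¹∫(S−1)e^{iky}đk < 0`
  at every `r`, `S = k/√(k²+16πρa)`, item evidence EVIDENCE-bogoliubov-g2.md), plus the canonical `+1/N`
  far-field bookkeeping (`P` has cell-mean `1`, far field `≈ 1 + 1/N`, so `C ≥ 1`).  `κ` is UNIVERSAL so
  that the stub composes with the contact stub's `κ(v)`; for small `κ` its region reaches into the
  two-body window `a ≪ r ≪ ρ^{-1/3}` where `P ≈ f² (1 + o(1)) < 1` with margin `2a/r ≍ (ρa³)^{1/3}κ^{-1/3}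
  ≫ √(ρa³)`, consistent (the Poisson engine is global in `r`).
* `AntibunchingGS_of` (sorry-free glue, below): `κ, ρ₀ᴬ` from the contact stub; `ρ₀ᴮ, Cᴮ` from the far
  stub at that `κ`; `C'` from the contact stub at level `Cᴮ`; `ρ₀ := min`, `C := max Cᴮ C'`, the
  intersection of the two eventual ranges, and for each `y` the dichotomy
  `(∃ m, ρ‖y − Lm‖³ ≤ κ) ∨ (∀ m, κ < ρ‖y − Lm‖³)`; monotonicity of `C ↦ ofReal (1 + C/(n+2))`.

Why the cut is not a costume/shred: stub B is the crux RESTRICTED to the screening regime (strictly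
weaker: the contact balls around every lattice point are removed), stub A is a CONDITIONAL transport lemma
(far level ⇒ contact level) with its own mechanism (subharmonicity where `e > 0`), implied by the crux but
implying neither the crux nor the summit; the whole difficulty is NOT hidden in one unnamed step — it sits
in the named stub B with the header's named engine.  BC3 probes `stub → AntibunchingGS`,
`stub → BoseEinsteinCondensation` by `first | exact? | simpa | aesop` (and each tactic separately) FAIL for
both stubs (seat NOTES.md / Lines/birth.md).  Hardest stub: `stub_farFieldAntibunching`.

Disproof used: none — the crux has no `Disproof.lean` / workfiles yet (`ledger crux ls`, 2026-08-17).
Negatives index (20 entries, 2026-08-17): nothing on pair densities / anti-bunching (BEC-side entries: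
SwapJensen 3980, BerryStiffPhaseLRO 14490 — unrelated objects).  Barriers (route header):
`KineticGapLengthScales(Narrow)` — no gap/localisation step, both stubs are properties of the exact
positive ground state (false for generic low-energy states: needles); `EnergyAsymptoticsWithoutCondensation
(Narrow)` — no energy asymptotics matched, only the PROFILE (sign) of the conditional energy `e(y)` enters
the intended engines; `BogoliubovPerturbationInfrared` — statements are about `|Ψ₀|²` (gauge-invariant);
Bogoliubov theory is evidence, not an engine.
-/

namespace Summit.AtomisticToContinuum.BoseEinsteinCondensation.Cruxes.AntibunchingGS.Birth

open MeasureTheory Filter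
open scoped ENNReal BigOperators
open Summit.AtomisticToContinuum.BoseEinsteinCondensation.Theses.BECLiebAntibunching

noncomputable section

/-! ## Registered stubs -/

/-- **Stub A — maximum-principle transport into the contact balls (conditional contact anti-bunching).**
For every bounded repulsive finite-range `v` there are a fraction `κ > 0` and a threshold `ρ₀ > 0` such
that for `0 < ρ < ρ₀` and every level `C` there is `C'` with, eventually in `n` (`N = n+2`,
`L = sideLength ρ (n+2)`): for every positive, translation-invariant periodic trial state `Ψ` attaining the
periodic ground-state energy, IF `L³ ∫_{cell^{n+1}} |Ψ((X 0 + y) :: X)|² dX ≤ 1 + C/(n+2)` at every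
separation `y` off the contact balls (`κ ≤ ρ‖y − latticeVec L m‖³` for all `m ∈ ℤ³`), THEN
`L³ ∫_{cell^{n+1}} |Ψ((X 0 + y) :: X)|² dX ≤ 1 + C'/(n+2)` at every `y` inside a contact ball
(`ρ‖y − latticeVec L m‖³ ≤ κ` for some `m`; torus distance of the pair `≤ (κ/ρ)^{1/3}`, a fixed fraction
of the mean interparticle distance).  The route header's child `ContactAntibunching` with its boundary
level made explicit; engine: `Δ_y P = e·P` with `e > 0` for `ρr³ ≲ 1/(4π)` (subharmonicity, no interior
maximum) — the many-body lift of LSSY Lemma C.2.  Size L. [cite: LSSY2005, App. C Lemma C.2]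
[cite: Lieb1963] -/
theorem stub_contactFromFarField : open Literature.MathematicalPhysics.QuantumManyBody.BoseGas in
    ∀ v : ℝ → ENNReal, IsRepulsiveFiniteRange v → (∃ M : NNReal, ∀ r, v r ≤ M) →
    ∃ κ : ℝ, 0 < κ ∧ ∃ ρ₀ : ℝ, 0 < ρ₀ ∧ ∀ ρ : ℝ, 0 < ρ → ρ < ρ₀ → ∀ C : ℝ, ∃ C' : ℝ,
    ∀ᶠ n : ℕ in Filter.atTop, ∀ Ψ : PeriodicTrialState (n + 2) (sideLength ρ (n + 2)),
    periodicEnergy v Ψ = periodicGroundStateEnergy v (n + 2) (sideLength ρ (n + 2)) →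
    (∀ X, 0 < (Ψ.ψ X).re ∧ (Ψ.ψ X).im = 0) →
    (∀ (X : Config (n + 2)) (t : Space), Ψ.ψ (fun i => X i + t) = Ψ.ψ X) →
    (∀ y : Space, (∀ m : Fin 3 → ℤ, κ ≤ ρ * ‖y - latticeVec (sideLength ρ (n + 2)) m‖ ^ 3) →
      ENNReal.ofReal (sideLength ρ (n + 2) ^ 3) *
          ∫⁻ X in cellN (n + 1) (sideLength ρ (n + 2)), (‖Ψ.ψ (Matrix.vecCons (X 0 + y) X)‖₊ : ENNReal) ^ 2 ≤
        ENNReal.ofReal (1 + C / (n + 2))) →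
    ∀ (y : Space) (m : Fin 3 → ℤ), ρ * ‖y - latticeVec (sideLength ρ (n + 2)) m‖ ^ 3 ≤ κ →
    ENNReal.ofReal (sideLength ρ (n + 2) ^ 3) *
        ∫⁻ X in cellN (n + 1) (sideLength ρ (n + 2)), (‖Ψ.ψ (Matrix.vecCons (X 0 + y) X)‖₊ : ENNReal) ^ 2 ≤
      ENNReal.ofReal (1 + C' / (n + 2)) := by
  sorry

/-- **Stub B — far-field anti-bunching off the contact balls (screening regime; THE HARD STUB).**  For
every bounded repulsive finite-range `v` and EVERY fraction `κ > 0` there is `ρ₀ > 0` such that for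
`0 < ρ < ρ₀` there is `C` with, eventually in `n`: every positive, translation-invariant periodic trial
state attaining the periodic ground-state energy has `L³ ∫_{cell^{n+1}} |Ψ((X 0 + y) :: X)|² dX ≤ 1 + C/(n+2)`
at every separation `y` with `κ ≤ ρ‖y − latticeVec L m‖³` for ALL `m ∈ ℤ³` (torus distance of the pair
`≥ (κ/ρ)^{1/3}`).  Intended engine: Poisson representation `P − 1 = G_T ∗ (eP)` with a screened
conditional-energy profile; canonical far field `≈ 1 + 1/N` (so `C ≥ 1`).  Size XL (the open core of the
crux). [cite: Lieb1963] [cite: CarlenJauslinLieb2021] [cite: LSSY2005, Ch. 5] -/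
theorem stub_farFieldAntibunching : open Literature.MathematicalPhysics.QuantumManyBody.BoseGas in
    ∀ v : ℝ → ENNReal, IsRepulsiveFiniteRange v → (∃ M : NNReal, ∀ r, v r ≤ M) →
    ∀ κ : ℝ, 0 < κ → ∃ ρ₀ : ℝ, 0 < ρ₀ ∧ ∀ ρ : ℝ, 0 < ρ → ρ < ρ₀ → ∃ C : ℝ, ∀ᶠ n : ℕ in Filter.atTop,
    ∀ Ψ : PeriodicTrialState (n + 2) (sideLength ρ (n + 2)),
    periodicEnergy v Ψ = periodicGroundStateEnergy v (n + 2) (sideLength ρ (n + 2)) →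
    (∀ X, 0 < (Ψ.ψ X).re ∧ (Ψ.ψ X).im = 0) →
    (∀ (X : Config (n + 2)) (t : Space), Ψ.ψ (fun i => X i + t) = Ψ.ψ X) →
    ∀ y : Space, (∀ m : Fin 3 → ℤ, κ ≤ ρ * ‖y - latticeVec (sideLength ρ (n + 2)) m‖ ^ 3) →
    ENNReal.ofReal (sideLength ρ (n + 2) ^ 3) *
        ∫⁻ X in cellN (n + 1) (sideLength ρ (n + 2)), (‖Ψ.ψ (Matrix.vecCons (X 0 + y) X)‖₊ : ENNReal) ^ 2 ≤
      ENNReal.ofReal (1 + C / (n + 2)) := by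
  sorry

/-! ## Glue (sorry-free) -/

/-- Monotonicity of the crux's right-hand side in the constant: `ofReal (1 + C/(n+2))` is nondecreasing
in `C`. [folklore] -/
theorem ofReal_one_add_div_mono (n : ℕ) {C C' : ℝ} (h : C ≤ C') :
    ENNReal.ofReal (1 + C / (n + 2)) ≤ ENNReal.ofReal (1 + C' / (n + 2)) := by
  apply ENNReal.ofReal_le_ofReal
  have hn : (0 : ℝ) < n + 2 := by positivity
  have : C / (n + 2) ≤ C' / (n + 2) := div_le_div_of_nonneg_right h hn.le
  linarith

/-- **`AntibunchingGS` from the registered stubs** (kernel-checked composition, no `sorry` of its own):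
the fraction `κ` and threshold `ρ₀ᴬ` from `stub_contactFromFarField`; `stub_farFieldAntibunching` at
that `κ` gives `ρ₀ᴮ` and, for `ρ < min ρ₀ᴬ ρ₀ᴮ`, the far level `Cᴮ`; the contact stub at level `Cᴮ` gives
`C'`; the crux constant is `max Cᴮ C'`; eventually in `n` (intersection of the two ranges), for the
ground state `Ψ` and a separation `y`: either `ρ‖y − Lm‖³ ≤ κ` for some lattice point (contact stub fed
with the far bound) or `κ < ρ‖y − Lm‖³` for all of them (far stub); conclusion = the crux BY NAME.
[folklore] -/
theorem AntibunchingGS_of : AntibunchingGS := by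
  intro v hv hM
  obtain ⟨κ, hκ, ρA, hρA, hA⟩ := stub_contactFromFarField v hv hM
  obtain ⟨ρB, hρB, hB⟩ := stub_farFieldAntibunching v hv hM κ hκ
  refine ⟨min ρA ρB, lt_min hρA hρB, fun ρ hρ hρlt => ?_⟩
  obtain ⟨CB, hCB⟩ := hB ρ hρ (hρlt.trans_le (min_le_right _ _))
  obtain ⟨C', hC'⟩ := hA ρ hρ (hρlt.trans_le (min_le_left _ _)) CB
  refine ⟨max CB C', ?_⟩
  filter_upwards [hCB, hC'] with n hnB hnA
  intro Ψ hE hpos hTI y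
  have hfar := hnB Ψ hE hpos hTI
  by_cases h : ∃ m : Fin 3 → ℤ,
      ρ * ‖y - Literature.MathematicalPhysics.QuantumManyBody.BoseGas.latticeVec
        (Literature.MathematicalPhysics.QuantumManyBody.BoseGas.sideLength ρ (n + 2)) m‖ ^ 3 ≤ κ
  · obtain ⟨m, hm⟩ := h
    exact (hnA Ψ hE hpos hTI hfar y m hm).trans (ofReal_one_add_div_mono n (le_max_right _ _))
  · push Not at h
    exact (hfar y fun m => (h m).le).trans (ofReal_one_add_div_mono n (le_max_left _ _))

end

end Summit.AtomisticToContinuum.BoseEinsteinCondensation.Cruxes.AntibunchingGS.Birth
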